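import Summits.QuantumFields.YangMills.Theorems.BalabanUVNodesN19KinkLowerBound
import Mathlib.Analysis.Complex.Exponential
import Mathlib.Analysis.Real.Pi.Bounds

/-!
# YM-DAG node N19 (= NE7 proper) — THE LOWER SIDE OF THE KINK, PART 3: `E_t(sin(a|x|)) ≥ a∕(20πt)` for `0 ≤ a ≤ t∕10`, and the cube faces —
# the SINGLE-MODE LAW of modules 119∕122 is TWO-SIDED (up to its `log²t`): `dist_∞(sin(ωΣ_{i≤d}|x_i|), Π_t) ≥ ωd∕(20πt)` for `ωd ≤ t∕10`

Cell `pub-ymgap`, HUMAN RULING D-0062 (Track A) ∕ D-0149 (work-bound push), R141 (C) wider-strategy seat `pub-ymgap-dag-n19-e` (strategy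
s3 = ALTERNATIVE CURRENCY), generation g31, module 3 (lineage module 134).  Route `Summits/QuantumFields/YangMills/Theses/BalabanUVNodes.lean`,
cluster item K3⁸ «SpineGivenEndpointR13SepCoPHV» (stmt-QuantumFields-27366); filed `--supports` that item `--as helper` (it proves no registered
stub).  COUNT-NEUTRAL: [folklore] approximation theory over Mathlib (`Complex.exp_bound'`, `MvPolynomial.aeval`, `Polynomial`) and PART 2
`…N19KinkLowerBound` BY NAME; no laws, no scheme object, no Theses import; NOT a discharge claim.

CONTENT.  §1 the sine Taylor tail: `sum_range_two_mul` · `im_cexp_taylor` (the imaginary part of `Σ_{j<2K}(iy)^j∕j!` is the odd-power sum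
`Σ_{k<K}(−1)^k y^{2k+1}∕(2k+1)!`) · ★ `abs_sin_sub_oddPowerSum_le` (`|sin y − Σ_{k<K}(−1)^k y^{2k+1}∕(2k+1)!| ≤ 2|y|^{2K}∕(2K)!` for
`|y| ≤ (2K+1)∕2`, Mathlib's `Complex.exp_bound'`).  §2 ★★★ `exists_le_abs_sin_mul_abs_sub_eval`: for `t ≥ 6`, `0 ≤ a ≤ t∕10` and every real
polynomial `p` of degree `≤ t` there is `x ∈ [−1,1]` with `|sin(a|x|) − p(x)| ≥ a∕(20πt)` (PART 2's odd-power sum with `n₀ = ⌊(t−1)∕2⌋` pays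
`a∕(π(9t+6)) ≥ a∕(10πt)`; the tail `2a^{2n₀+2}∕(2n₀+2)! ≤ 2a∕(243t)` by `n! ≥ (n∕e)^n` — `Real.pow_div_factorial_le_exp` — and `ea∕(2n₀+1) ≤ 1∕3`;
`1∕(10π) − 2∕243 ≥ 1∕(20π)` as `40π < 126`).  §3 the cube (degree model of modules 109∕117∕122, `MvPolynomial.totalDegree`):
`exists_polynomial_restrictLine` (a real `MvPolynomial` of total degree `≤ t` restricted to an affine line `s ↦ x₀ + s·v` is a real polynomial
of degree `≤ t`: `MvPolynomial.aeval (C x₀ᵢ + C vᵢ·X)`) · `sum_abs_lineConfig` (the partial diagonals `s` on `A`, `b` off `A`) ·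
★★★ `exists_le_abs_sin_l1Norm_sub_eval` — **for `t ≥ 6`, `ω ≥ 0`, `ωd ≤ t∕10` (`d = |ι|`) and every `P : MvPolynomial ι ℝ` of total degree
`≤ t` there is `x ∈ [−1,1]^ι` with `|sin(ωΣ_i|x_i|) − P(x)| ≥ ωd∕(20πt)`** (the diagonal) · ★★ `exists_le_abs_l1Norm_sub_eval` (`S_d = Σ_i|x_i|`
itself: `≥ d∕(π(9t+6))`, all `t ≥ 1`) · ★★ `exists_le_abs_hinge_l1Norm_sub_eval` (the hinges `|S_d − c|`: `≥ k∕(π(9t+6))` for every `k ≤ d` with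
`c ∈ [0, d−k]`, by `k` moving coordinates and frozen mass `c`) · ★ `exists_le_abs_hinge_l1Norm_sub_eval'` (`c ∈ [k, d]`: frozen mass `c − k`,
the kink read downwards).

READING (HOME `CURRENCY-MAP.md`, honest).  With module 122 (`≤ 300·log₂t·(log₂t + 4ωd)∕t`) the single-mode row is now TWO-SIDED up to the
scheme's `log²t`: `ωd∕(20πt) ≤ dist_∞(sin(ωS_d), Π_t) ≤ 300log₂t(log₂t + 4ωd)∕t` on `log₂t ≲ ωd ≤ t∕10`; the hinge row (module 121:
`≤ 200·d·log₂t(log₂t+7)∕t`) is two-sided up to `log²t` for `c ≤ d∕2` (`k = d − ⌈c⌉`) and for `c ≥ d∕2` (`k = ⌊c⌋`); `S_d` itself is two-sided up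
to the constant (`d∕(π(9t+6)) ≤ · ≤ dπ∕(2(t+1))`-type Jackson, module 111).  The `cos` face along the diagonal is real-analytic (no kink) — no
lower bound of this kind is claimed for `cos(ωS_d)` alone; the complex mode `e^{iωS_d}` inherits the `sin` bound.

HONEST FRAMING (binding).  Elementary and [folklore]; NO consumer in the DAG today (an optimality map of the seat's own currency, degree model);
nothing of Bałaban's instantiated; NE7 NOT PRINTED, NOT proved; N19 NOT discharged; count-neutral.  One finite `T⁴` programme at fixed `ε`;
nothing continuum ∕ `ℝ⁴` ∕ OS ∕ mass-gap ∕ Clay.  Constants not optimised.  0 `def` ∕ 0 `sorry`.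
-/

noncomputable section

open Finset Real Complex Polynomial

namespace Summit.QuantumFields.YangMills.Theorems.BalabanUVNodesN19SingleModeLowerBound

open Summit.QuantumFields.YangMills.Theorems.BalabanUVNodesN19KinkLowerBound
  (exists_le_abs_oddPowerSum_sub_eval exists_le_abs_mul_abs_sub_eval)

/-! ## §1 The sine Taylor tail [folklore] -/

/-- Parity split of a range sum: `Σ_{j<2K} F j = Σ_{k<K}(F(2k) + F(2k+1))`. [bookkeeping] -/
theorem sum_range_two_mul {M : Type*} [AddCommMonoid M] (F : ℕ → M) (K : ℕ) :
    ∑ j ∈ range (2 * K), F j = ∑ k ∈ range K, (F (2 * k) + F (2 * k + 1)) := by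
  induction K with
  | zero => simp
  | succ K ih =>
    rw [show 2 * (K + 1) = 2 * K + 1 + 1 by ring, Finset.sum_range_succ, Finset.sum_range_succ, ih,
      Finset.sum_range_succ, add_assoc]

/-- The imaginary part of the Taylor polynomial of `e^{iy}` of even order is the odd-power sum:
`Im Σ_{j<2K}(iy)^j∕j! = Σ_{k<K}(−1)^k y^{2k+1}∕(2k+1)!`. [folklore] -/
theorem im_cexp_taylor (y : ℝ) (K : ℕ) :
    (∑ j ∈ range (2 * K), ((y : ℂ) * I) ^ j / (j.factorial : ℂ)).im =
      ∑ k ∈ range K, (-1) ^ k * y ^ (2 * k + 1) / ((2 * k + 1).factorial : ℝ) := by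
  rw [sum_range_two_mul, Complex.im_sum]
  refine Finset.sum_congr rfl fun k _ => ?_
  have hev : ((y : ℂ) * I) ^ (2 * k) = ((y ^ (2 * k) * (-1) ^ k : ℝ) : ℂ) := by
    rw [mul_pow, pow_mul Complex.I 2 k, Complex.I_sq]
    push_cast
    ring
  have hodd : ((y : ℂ) * I) ^ (2 * k + 1) = ((y ^ (2 * k + 1) * (-1) ^ k : ℝ) : ℂ) * I := by
    rw [pow_succ, hev]
    push_cast
    ring
  have e1 : (((y ^ (2 * k) * (-1) ^ k : ℝ) : ℂ) / ((2 * k).factorial : ℂ)).im = 0 := by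
    rw [show ((2 * k).factorial : ℂ) = (((2 * k).factorial : ℝ) : ℂ) by norm_cast, ← Complex.ofReal_div,
      Complex.ofReal_im]
  have e2 : (((y ^ (2 * k + 1) * (-1) ^ k : ℝ) : ℂ) * I / ((2 * k + 1).factorial : ℂ)).im =
      y ^ (2 * k + 1) * (-1) ^ k / ((2 * k + 1).factorial : ℝ) := by
    set r : ℝ := y ^ (2 * k + 1) * (-1) ^ k with hr
    rw [show ((2 * k + 1).factorial : ℂ) = (((2 * k + 1).factorial : ℝ) : ℂ) by norm_cast, mul_div_right_comm,
      ← Complex.ofReal_div, Complex.im_ofReal_mul, Complex.I_im, mul_one]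
  rw [Complex.add_im, hev, hodd, e1, e2]
  ring

/-- ★ **THE SINE TAYLOR TAIL.**  `|sin y − Σ_{k<K}(−1)^k y^{2k+1}∕(2k+1)!| ≤ 2|y|^{2K}∕(2K)!` whenever `|y| ≤ (2K+1)∕2`
(Mathlib's `Complex.exp_bound'` at `iy`, imaginary parts). [folklore] -/
theorem abs_sin_sub_oddPowerSum_le (y : ℝ) (K : ℕ) (hy : |y| ≤ (2 * K + 1) / 2) :
    |Real.sin y - ∑ k ∈ range K, (-1) ^ k * y ^ (2 * k + 1) / ((2 * k + 1).factorial : ℝ)| ≤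
      2 * |y| ^ (2 * K) / ((2 * K).factorial : ℝ) := by
  have hnorm : ‖(y : ℂ) * I‖ = |y| := by simp
  have hx : ‖(y : ℂ) * I‖ / ((2 * K).succ : ℕ) ≤ 1 / 2 := by
    rw [hnorm, div_le_iff₀ (by positivity)]
    push_cast
    linarith
  have hb := Complex.exp_bound' hx
  rw [hnorm] at hb
  have him : (Complex.exp ((y : ℂ) * I) - ∑ j ∈ range (2 * K), ((y : ℂ) * I) ^ j / (j.factorial : ℂ)).im =
      Real.sin y - ∑ k ∈ range K, (-1) ^ k * y ^ (2 * k + 1) / ((2 * k + 1).factorial : ℝ) := by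
    rw [Complex.sub_im, Complex.exp_ofReal_mul_I_im, im_cexp_taylor]
  rw [← him]
  refine (Complex.abs_im_le_norm _).trans (hb.trans_eq ?_)
  ring

/-! ## §2 The kinked sine `sin(a|x|)` [folklore] -/

/-- ★★★ **THE LOWER SIDE OF THE SINGLE MODE IN DIMENSION ONE.**  For `t ≥ 6`, `0 ≤ a ≤ t∕10` and every real polynomial `p` of degree `≤ t`
there is `x ∈ [−1,1]` with `|sin(a|x|) − p(x)| ≥ a∕(20πt)`. [folklore] -/
theorem exists_le_abs_sin_mul_abs_sub_eval {t : ℕ} (ht : 6 ≤ t) {a : ℝ} (ha : 0 ≤ a) (hat : a ≤ t / 10) (p : ℝ[X])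
    (hp : p.natDegree ≤ t) :
    ∃ x ∈ Set.Icc (-1 : ℝ) 1, a / (20 * π * t) ≤ |Real.sin (a * |x|) - p.eval x| := by
  -- the truncation order: `n₀ = ⌊(t−1)/2⌋`, `2n₀ + 1 ≤ t ≤ 2n₀ + 2`
  obtain ⟨n₀, hn₀, hn₀'⟩ : ∃ n₀ : ℕ, 2 * n₀ + 1 ≤ t ∧ t ≤ 2 * n₀ + 2 := ⟨(t - 1) / 2, by omega, by omega⟩
  obtain ⟨x, hx, hmain⟩ := exists_le_abs_oddPowerSum_sub_eval (by omega : 1 ≤ t) hn₀ ha p hp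
  refine ⟨x, hx, ?_⟩
  have ht6 : (6 : ℝ) ≤ t := by exact_mod_cast ht
  have ht0 : (0 : ℝ) < t := by linarith
  have hx1 : |x| ≤ 1 := abs_le.2 ⟨hx.1, hx.2⟩
  -- the tail
  have hy : |a * (|x|)| ≤ (2 * ((n₀ + 1 : ℕ) : ℝ) + 1) / 2 := by
    rw [abs_mul, abs_abs, abs_of_nonneg ha]
    have h1 : a * |x| ≤ a := by nlinarith [abs_nonneg x]
    have h2 : (t : ℝ) ≤ 2 * n₀ + 2 := by exact_mod_cast hn₀'
    push_cast
    nlinarith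
  have htail := abs_sin_sub_oddPowerSum_le (a * |x|) (n₀ + 1) hy
  have hsum : ∑ k ∈ range (n₀ + 1), (-1) ^ k * (a * |x|) ^ (2 * k + 1) / ((2 * k + 1).factorial : ℝ) =
      ∑ k ∈ range (n₀ + 1), (-1) ^ k * a ^ (2 * k + 1) / ((2 * k + 1).factorial : ℝ) * |x| ^ (2 * k + 1) := by
    refine Finset.sum_congr rfl fun k _ => ?_
    rw [mul_pow]
    ring
  rw [hsum] at htail
  -- size of the tail: `2 (a|x|)^{2n₀+2}/(2n₀+2)! ≤ 2a/(243 t)`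
  set n' : ℕ := 2 * n₀ + 1 with hn'
  have hn'5 : (5 : ℝ) ≤ n' := by
    have : 5 ≤ n' := by omega
    exact_mod_cast this
  have hn't : (t : ℝ) - 1 ≤ n' := by
    have : t - 1 ≤ n' := by omega
    have h' : ((t - 1 : ℕ) : ℝ) = (t : ℝ) - 1 := by rw [Nat.cast_sub (by omega)]; simp
    rw [← h']
    exact_mod_cast this
  have hn'0 : (0 : ℝ) < n' := by linarith
  -- `n'! ≥ (n'/e)^{n'}`
  have hfac : (n' : ℝ) ^ n' / (n'.factorial : ℝ) ≤ Real.exp 1 ^ n' := by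
    have := Real.pow_div_factorial_le_exp (n' : ℝ) (Nat.cast_nonneg n') n'
    rwa [show ((n' : ℕ) : ℝ) = (n' : ℝ) * 1 by ring, Real.exp_nat_mul, mul_one] at this
  have hfac0 : (0 : ℝ) < n'.factorial := by positivity
  -- `a e / n' ≤ 1/3`
  have hr : a * Real.exp 1 / n' ≤ 1 / 3 := by
    rw [div_le_div_iff₀ hn'0 (by norm_num : (0 : ℝ) < 3)]
    have he := Real.exp_one_lt_d9
    nlinarith [Real.exp_pos 1]
  have hr0 : 0 ≤ a * Real.exp 1 / n' := by positivity
  -- `a^{n'}/n'! ≤ (a e/n')^{n'} ≤ (1/3)^5`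
  have hpow : a ^ n' / (n'.factorial : ℝ) ≤ (1 / 3 : ℝ) ^ 5 := by
    have h1 : a ^ n' / (n'.factorial : ℝ) ≤ (a * Real.exp 1 / n') ^ n' := by
      rw [div_pow, mul_pow, div_le_div_iff₀ hfac0 (by positivity)]
      have hnn : (n' : ℝ) ^ n' ≤ Real.exp 1 ^ n' * n'.factorial := by
        rwa [div_le_iff₀ hfac0] at hfac
      calc a ^ n' * (n' : ℝ) ^ n' ≤ a ^ n' * (Real.exp 1 ^ n' * n'.factorial) :=
            mul_le_mul_of_nonneg_left hnn (pow_nonneg ha _)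
        _ = a ^ n' * Real.exp 1 ^ n' * n'.factorial := by ring
    calc a ^ n' / (n'.factorial : ℝ) ≤ (a * Real.exp 1 / n') ^ n' := h1
      _ ≤ (1 / 3 : ℝ) ^ n' := pow_le_pow_left₀ hr0 hr _
      _ ≤ (1 / 3 : ℝ) ^ 5 := pow_le_pow_of_le_one (by norm_num) (by norm_num) (by omega)
  have htail' : 2 * |a * (|x|)| ^ (2 * (n₀ + 1)) / ((2 * (n₀ + 1)).factorial : ℝ) ≤ 2 * a / (243 * t) := by
    have hax : |a * (|x|)| ≤ a := by
      rw [abs_mul, abs_abs, abs_of_nonneg ha]; nlinarith [abs_nonneg x]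
    have hax0 : 0 ≤ |a * (|x|)| := abs_nonneg _
    have h2 : 2 * (n₀ + 1) = n' + 1 := by omega
    rw [h2, Nat.factorial_succ, pow_succ]
    push_cast
    have hnum : |a * (|x|)| ^ n' * |a * (|x|)| ≤ a ^ n' * a :=
      mul_le_mul (pow_le_pow_left₀ hax0 hax _) hax hax0 (pow_nonneg ha _)
    have hn1t : (t : ℝ) ≤ (n' : ℝ) + 1 := by linarith
    calc 2 * (|a * (|x|)| ^ n' * |a * (|x|)|) / (((n' : ℝ) + 1) * n'.factorial)
        ≤ 2 * (a ^ n' * a) / (((n' : ℝ) + 1) * n'.factorial) := by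
          gcongr
      _ = 2 * a * (a ^ n' / n'.factorial) / ((n' : ℝ) + 1) := by
          field_simp
      _ ≤ 2 * a * (1 / 3 : ℝ) ^ 5 / ((n' : ℝ) + 1) := by
          gcongr
      _ ≤ 2 * a * (1 / 3 : ℝ) ^ 5 / t := by
          gcongr
      _ = 2 * a / (243 * t) := by ring
  -- assemble: `a/(π(9t+6)) − 2a/(243t) ≥ a/(20πt)`
  have hpi := Real.pi_lt_d2
  have hpi0 := Real.pi_pos
  have hstep1 : a / (10 * π * t) ≤ a / (π * (9 * t + 6)) :=
    div_le_div_of_nonneg_left ha (by positivity) (by nlinarith)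
  have hstep2 : a / (20 * π * t) ≤ a / (10 * π * t) - 2 * a / (243 * t) := by
    rw [div_sub_div _ _ (by positivity) (by positivity), div_le_div_iff₀ (by positivity) (by positivity)]
    have h5 : 0 ≤ a * t * t * π * (2430 - 400 * π) := mul_nonneg (by positivity) (by nlinarith)
    nlinarith [h5]
  have hsplit : (∑ k ∈ range (n₀ + 1), (-1) ^ k * a ^ (2 * k + 1) / ((2 * k + 1).factorial : ℝ) * |x| ^ (2 * k + 1)) -
      p.eval x = (Real.sin (a * |x|) - p.eval x) - (Real.sin (a * |x|) - ∑ k ∈ range (n₀ + 1),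
          (-1) ^ k * a ^ (2 * k + 1) / ((2 * k + 1).factorial : ℝ) * |x| ^ (2 * k + 1)) := by
    ring
  have htri : |(∑ k ∈ range (n₀ + 1), (-1) ^ k * a ^ (2 * k + 1) / ((2 * k + 1).factorial : ℝ) * |x| ^ (2 * k + 1)) -
      p.eval x| ≤ |Real.sin (a * |x|) - p.eval x| +
        |Real.sin (a * |x|) - ∑ k ∈ range (n₀ + 1),
          (-1) ^ k * a ^ (2 * k + 1) / ((2 * k + 1).factorial : ℝ) * |x| ^ (2 * k + 1)| := by
    rw [hsplit]
    exact abs_sub _ _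
  linarith

/-! ## §3 The cube: restriction to a line, the single mode, `S_d`, the hinges [folklore] -/

variable {ι : Type*} [Fintype ι] [DecidableEq ι]

omit [Fintype ι] [DecidableEq ι] in
/-- **RESTRICTION TO AN AFFINE LINE.**  For `P : MvPolynomial ι ℝ` and `x₀ v : ι → ℝ` there is a real polynomial `p` of degree
`≤ totalDegree P` with `p(s) = P(x₀ + s·v)` for all `s`. [folklore] -/
theorem exists_polynomial_restrictLine (P : MvPolynomial ι ℝ) (x₀ v : ι → ℝ) :
    ∃ p : ℝ[X], p.natDegree ≤ P.totalDegree ∧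
      ∀ s : ℝ, p.eval s = MvPolynomial.eval (fun i => x₀ i + s * v i) P := by
  classical
  set g : ι → ℝ[X] := fun i => Polynomial.C (v i) * Polynomial.X + Polynomial.C (x₀ i) with hg
  refine ⟨MvPolynomial.aeval g P, ?_, fun s => ?_⟩
  · -- degree: monomial by monomial
    rw [MvPolynomial.as_sum P, map_sum]
    refine Polynomial.natDegree_sum_le_of_forall_le _ _ fun m hm => ?_
    rw [MvPolynomial.aeval_monomial, Finsupp.prod]
    refine (Polynomial.natDegree_mul_le).trans ?_
    have hC : (algebraMap ℝ ℝ[X] (MvPolynomial.coeff m P)).natDegree = 0 := Polynomial.natDegree_C _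
    rw [hC, zero_add]
    refine (Polynomial.natDegree_prod_le _ _).trans ?_
    refine le_trans (Finset.sum_le_sum fun i _ => (Polynomial.natDegree_pow_le).trans
      (Nat.mul_le_mul_left (m i) (show (g i).natDegree ≤ 1 from ?_))) ?_
    · exact Polynomial.natDegree_linear_le
    · simpa [Finsupp.sum] using MvPolynomial.le_totalDegree hm
  · rw [← Polynomial.coe_aeval_eq_eval, show (Polynomial.aeval s) (MvPolynomial.aeval g P) =
      ((Polynomial.aeval s).comp (MvPolynomial.aeval g)) P from rfl, MvPolynomial.comp_aeval]
    show MvPolynomial.eval (fun i => (Polynomial.aeval s) (g i)) P = _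
    have hfun : (fun i => (Polynomial.aeval s) (g i)) = fun i => x₀ i + s * v i := by
      funext i
      simp only [hg, Polynomial.coe_aeval_eq_eval, Polynomial.eval_add, Polynomial.eval_mul, Polynomial.eval_C,
        Polynomial.eval_X]
      ring
    rw [hfun]

/-- THE PARTIAL DIAGONALS.  For `A ⊆ ι` and `b ≥ 0`, the configuration `x_i = s` (`i ∈ A`), `x_i = b` (`i ∉ A`) has
`Σ_i|x_i| = |A|·|s| + (|ι| − |A|)·b`. [bookkeeping] -/
theorem sum_abs_lineConfig (A : Finset ι) {b : ℝ} (hb : 0 ≤ b) (s : ℝ) :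
    ∑ i, |(if i ∈ A then (0 : ℝ) else b) + s * (if i ∈ A then 1 else 0)| =
      A.card * |s| + (Fintype.card ι - A.card) * b := by
  have h : ∀ i, |(if i ∈ A then (0 : ℝ) else b) + s * (if i ∈ A then 1 else 0)| = if i ∈ A then |s| else b := by
    intro i
    split_ifs <;> simp [abs_of_nonneg hb]
  simp_rw [h, Finset.sum_ite, Finset.sum_const, nsmul_eq_mul, Finset.filter_mem_eq_inter, Finset.univ_inter,
    Finset.filter_not, Finset.filter_mem_eq_inter, Finset.univ_inter, Finset.card_univ_sdiff]
  rw [Nat.cast_sub (Finset.card_le_univ A)]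

omit [DecidableEq ι] in
/-- ★★★ **THE LOWER SIDE OF THE SINGLE-MODE LAW ON THE CUBE.**  For `t ≥ 6`, `ω ≥ 0` with `ω·|ι| ≤ t∕10` and every
`P : MvPolynomial ι ℝ` of total degree `≤ t` there is `x ∈ [−1,1]^ι` with `|sin(ωΣ_i|x_i|) − P(x)| ≥ ω|ι|∕(20πt)` (the diagonal `x = s·𝟙`
and §2). [folklore] -/
theorem exists_le_abs_sin_l1Norm_sub_eval {t : ℕ} (ht : 6 ≤ t) {ω : ℝ} (hω : 0 ≤ ω)
    (hωd : ω * Fintype.card ι ≤ t / 10) (P : MvPolynomial ι ℝ) (hP : P.totalDegree ≤ t) :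
    ∃ x : ι → ℝ, (∀ i, x i ∈ Set.Icc (-1 : ℝ) 1) ∧
      ω * Fintype.card ι / (20 * π * t) ≤ |Real.sin (ω * ∑ i, |x i|) - MvPolynomial.eval x P| := by
  classical
  obtain ⟨p, hpdeg, hpev⟩ := exists_polynomial_restrictLine P (fun _ => 0) (fun _ => 1)
  obtain ⟨s, hs, h⟩ := exists_le_abs_sin_mul_abs_sub_eval ht (mul_nonneg hω (Nat.cast_nonneg _)) hωd p (hpdeg.trans hP)
  refine ⟨fun _ => s, fun _ => hs, ?_⟩
  have hsum : ∑ _i : ι, |s| = Fintype.card ι * |s| := by simp [Finset.sum_const, Finset.card_univ]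
  have hev : MvPolynomial.eval (fun _ : ι => s) P = p.eval s := by
    rw [hpev s]
    simp
  rw [hsum, hev, ← mul_assoc]
  exact h

omit [DecidableEq ι] in
/-- ★★ **`S_d` ITSELF**: for `t ≥ 1` and every `P : MvPolynomial ι ℝ` of total degree `≤ t` there is `x ∈ [−1,1]^ι` with
`|Σ_i|x_i| − P(x)| ≥ |ι|∕(π(9t+6))` (two-sided with the Jackson rate of module 111 up to the constant). [folklore] -/
theorem exists_le_abs_l1Norm_sub_eval {t : ℕ} (ht : 1 ≤ t) (P : MvPolynomial ι ℝ) (hP : P.totalDegree ≤ t) :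
    ∃ x : ι → ℝ, (∀ i, x i ∈ Set.Icc (-1 : ℝ) 1) ∧
      Fintype.card ι / (π * (9 * t + 6)) ≤ |(∑ i, |x i|) - MvPolynomial.eval x P| := by
  classical
  obtain ⟨p, hpdeg, hpev⟩ := exists_polynomial_restrictLine P (fun _ => 0) (fun _ => 1)
  obtain ⟨s, hs, h⟩ := exists_le_abs_mul_abs_sub_eval ht (Nat.cast_nonneg (Fintype.card ι)) p (hpdeg.trans hP)
  refine ⟨fun _ => s, fun _ => hs, ?_⟩
  have hsum : ∑ _i : ι, |s| = Fintype.card ι * |s| := by simp [Finset.sum_const, Finset.card_univ]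
  have hev : MvPolynomial.eval (fun _ : ι => s) P = p.eval s := by
    rw [hpev s]
    simp
  rw [hsum, hev]
  exact h

/-- ★★ **THE HINGES `|S_d − c|`, kink read upwards.**  For `t ≥ 1`, `k ≤ |ι|`, `c ∈ [0, |ι| − k]` and every `P : MvPolynomial ι ℝ` of
total degree `≤ t` there is `x ∈ [−1,1]^ι` with `||Σ_i|x_i| − c| − P(x)| ≥ k∕(π(9t+6))` (`k` coordinates moving along `s`, the other
`|ι| − k` frozen at the common height `c∕(|ι| − k)`; along this line `|S − c| = k|s|`). [folklore] -/
theorem exists_le_abs_hinge_l1Norm_sub_eval {t : ℕ} (ht : 1 ≤ t) {k : ℕ} (hk : k ≤ Fintype.card ι) {c : ℝ} (hc0 : 0 ≤ c)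
    (hck : c ≤ Fintype.card ι - k) (P : MvPolynomial ι ℝ) (hP : P.totalDegree ≤ t) :
    ∃ x : ι → ℝ, (∀ i, x i ∈ Set.Icc (-1 : ℝ) 1) ∧
      k / (π * (9 * t + 6)) ≤ |(|(∑ i, |x i|) - c|) - MvPolynomial.eval x P| := by
  obtain ⟨A, -, hA⟩ := Finset.exists_subset_card_eq (s := (Finset.univ : Finset ι)) (n := k)
    (by simpa [Finset.card_univ] using hk)
  -- the frozen height
  obtain ⟨b, hb0, hb1, hbmass⟩ : ∃ b : ℝ, 0 ≤ b ∧ b ≤ 1 ∧ ((Fintype.card ι : ℝ) - k) * b = c := by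
    by_cases hlt : k < Fintype.card ι
    · have hpos : (0 : ℝ) < (Fintype.card ι : ℝ) - k := by
        have : (k : ℝ) < Fintype.card ι := by exact_mod_cast hlt
        linarith
      exact ⟨c / ((Fintype.card ι : ℝ) - k), div_nonneg hc0 hpos.le, by rwa [div_le_one hpos],
        mul_div_cancel₀ _ hpos.ne'⟩
    · have heq : (Fintype.card ι : ℝ) - k = 0 := by
        have : k = Fintype.card ι := le_antisymm hk (not_lt.1 hlt)
        rw [this]; ring
      refine ⟨0, le_rfl, zero_le_one, ?_⟩
      rw [heq] at hck
      rw [heq]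
      linarith
  set x₀ : ι → ℝ := fun i => if i ∈ A then 0 else b with hx₀
  set v : ι → ℝ := fun i => if i ∈ A then 1 else 0 with hv
  obtain ⟨p, hpdeg, hpev⟩ := exists_polynomial_restrictLine P x₀ v
  obtain ⟨s, hs, h⟩ := exists_le_abs_mul_abs_sub_eval ht (Nat.cast_nonneg k) p (hpdeg.trans hP)
  refine ⟨fun i => x₀ i + s * v i, fun i => ?_, ?_⟩
  · simp only [hx₀, hv]
    split_ifs
    · simpa using hs
    · simp only [mul_zero, add_zero, Set.mem_Icc]
      exact ⟨by linarith, hb1⟩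
  have hsum : ∑ i, |x₀ i + s * v i| = k * |s| + c := by
    simp only [hx₀, hv]
    rw [sum_abs_lineConfig A hb0 s, hA, hbmass]
  rw [hsum, ← hpev s, add_sub_cancel_right, abs_mul, abs_abs, Nat.abs_cast]
  exact h

/-- ★ **THE HINGES `|S_d − c|`, kink read downwards.**  For `t ≥ 1`, `k ≤ |ι|`, `c ∈ [k, |ι|]` and every `P : MvPolynomial ι ℝ` of total
degree `≤ t` there is `x ∈ [−1,1]^ι` with `||Σ_i|x_i| − c| − P(x)| ≥ k∕(π(9t+6))` (frozen mass `c − k`; along the line `|S − c| = k(1 − |s|)`,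
and `k − p` is again a polynomial of degree `≤ t`). [folklore] -/
theorem exists_le_abs_hinge_l1Norm_sub_eval' {t : ℕ} (ht : 1 ≤ t) {k : ℕ} (hk : k ≤ Fintype.card ι) {c : ℝ} (hkc : (k : ℝ) ≤ c)
    (hcd : c ≤ Fintype.card ι) (P : MvPolynomial ι ℝ) (hP : P.totalDegree ≤ t) :
    ∃ x : ι → ℝ, (∀ i, x i ∈ Set.Icc (-1 : ℝ) 1) ∧
      k / (π * (9 * t + 6)) ≤ |(|(∑ i, |x i|) - c|) - MvPolynomial.eval x P| := by
  obtain ⟨A, -, hA⟩ := Finset.exists_subset_card_eq (s := (Finset.univ : Finset ι)) (n := k)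
    (by simpa [Finset.card_univ] using hk)
  obtain ⟨b, hb0, hb1, hbmass⟩ : ∃ b : ℝ, 0 ≤ b ∧ b ≤ 1 ∧ ((Fintype.card ι : ℝ) - k) * b = c - k := by
    by_cases hlt : k < Fintype.card ι
    · have hpos : (0 : ℝ) < (Fintype.card ι : ℝ) - k := by
        have : (k : ℝ) < Fintype.card ι := by exact_mod_cast hlt
        linarith
      exact ⟨(c - k) / ((Fintype.card ι : ℝ) - k), div_nonneg (by linarith) hpos.le,
        by rw [div_le_one hpos]; linarith, mul_div_cancel₀ _ hpos.ne'⟩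
    · have heq' : k = Fintype.card ι := le_antisymm hk (not_lt.1 hlt)
      have heq : (Fintype.card ι : ℝ) - k = 0 := by rw [heq']; ring
      refine ⟨0, le_rfl, zero_le_one, ?_⟩
      rw [heq, zero_mul]
      have : (Fintype.card ι : ℝ) = k := by rw [heq']
      linarith
  set x₀ : ι → ℝ := fun i => if i ∈ A then 0 else b with hx₀
  set v : ι → ℝ := fun i => if i ∈ A then 1 else 0 with hv
  obtain ⟨p, hpdeg, hpev⟩ := exists_polynomial_restrictLine P x₀ v
  have hqdeg : (Polynomial.C (k : ℝ) - p).natDegree ≤ t := by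
    refine (Polynomial.natDegree_sub_le _ _).trans (max_le ?_ (hpdeg.trans hP))
    simp
  obtain ⟨s, hs, h⟩ := exists_le_abs_mul_abs_sub_eval ht (Nat.cast_nonneg k) (Polynomial.C (k : ℝ) - p) hqdeg
  refine ⟨fun i => x₀ i + s * v i, fun i => ?_, ?_⟩
  · simp only [hx₀, hv]
    split_ifs
    · simpa using hs
    · simp only [mul_zero, add_zero, Set.mem_Icc]
      exact ⟨by linarith, hb1⟩
  have hsum : ∑ i, |x₀ i + s * v i| = k * |s| + (c - k) := by
    simp only [hx₀, hv]
    rw [sum_abs_lineConfig A hb0 s, hA, hbmass]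
  have hs1 : |s| ≤ 1 := abs_le.2 ⟨hs.1, hs.2⟩
  have habs : |(k : ℝ) * |s| + (c - k) - c| = k - k * |s| := by
    rw [show (k : ℝ) * |s| + (c - k) - c = -(k - k * |s|) by ring, abs_neg, abs_of_nonneg]
    nlinarith [abs_nonneg s, (Nat.cast_nonneg k : (0 : ℝ) ≤ k)]
  rw [hsum, ← hpev s, habs]
  rw [Polynomial.eval_sub, Polynomial.eval_C] at h
  calc (k : ℝ) / (π * (9 * t + 6)) ≤ |(k : ℝ) * |s| - (k - p.eval s)| := h
    _ = |(k : ℝ) - k * |s| - p.eval s| := by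
        rw [← abs_neg]
        ring_nf

end Summit.QuantumFields.YangMills.Theorems.BalabanUVNodesN19SingleModeLowerBound

end
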